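import Summits.NavierStokesRegularity.NavierStokesRegularity.Theses.PerpetualPump
import Summits.NavierStokesRegularity.NavierStokesRegularity.Theorems.PerpetualPumpEulerTypeIGlueCubic
import Summits.NavierStokesRegularity.NavierStokesRegularity.Theorems.PerpetualPumpEulerTypeIGlueIdentityTests
import Summits.NavierStokesRegularity.NavierStokesRegularity.Theorems.PerpetualPumpEulerTypeIGlueTestToH10
import Summits.NavierStokesRegularity.NavierStokesRegularity.Theorems.PerpetualPumpEulerTypeIGlueMemH10
import Summits.NavierStokesRegularity.NavierStokesRegularity.Theorems.PerpetualPumpEulerTypeIGlueContinuity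
import Summits.NavierStokesRegularity.NavierStokesRegularity.Theorems.PerpetualPumpEulerTypeIGlueNormalise
import Summits.NavierStokesRegularity.NavierStokesRegularity.Theorems.PerpetualPumpEulerTypeIGlueBackEnd

/-!
# Route PerpetualPump · crux `EulerTypeIGlue` (stmt-NavierStokesRegularity-1838) — PROOF

`EulerTypeIGlue := Thesis → NoTypeIClay`: Tao's abstract Type-I exclusion (for every symmetric averaging
datum with cancellation, an `H¹⁰_df`-mild solution with the `L^∞` rate `M/√(T-t)` extends past `T`),
instantiated at the Euler datum (`AveragingDatum.euler`, `euler_form = eulerForm`), gives: a classical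
solution of Navier–Stokes on `[0,T)` (viscosity `ν > 0`), Leray–Hopf from its rapidly decaying datum and
blowing up at most at the Type-I rate, extends classically past `T`. Line `Sketch` of the crux chain
(cards `pair-kato-mild-identity` + `h10-continuity-certificate`):

1. `U t = [(u t)^ℂ] ∈ L²(ℝ³;ℂ³)` is `H¹⁰_df`-valued and `H¹⁰`-continuous on `[0,T)` (`stub_memH10`,
   `stub_continuity`: slab Sobolev bounds of Tao 2013 + Fourier-side interpolation);
2. `U` solves Tao's mild identity (1.15) at viscosity `ν`: the x-side duality-form identity of the classical
   solution (`isKatoSolutionOn_of_classical`) is carried over by the heat dictionary and the cubic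
   Plancherel identity `⟨B([f^ℂ],[f^ℂ]),[ψ^ℂ]⟩ = ∫⟪f,(f·∇)ψ⟫` (`stub_identityTests`, `stub_cubic`), then
   extended from `C_{c,σ}^∞` tests to all of `H¹⁰_df` by `L²` closure (`stub_testToH10`);
3. the time rescaling `W s = ν⁻¹ • U (s/ν)` is a unit-viscosity Euler-datum mild solution on `[0,νT)` with
   the rate `ν^{-1/2}M/√(νT-s)` (`stub_normalise`), so the Thesis yields a mild extension `v` past `νT`;
4. `H¹⁰`-continuity of `v` bounds `u` in `L^∞` up to `T`, and Robinson–Rodrigo–Sadowski Thm. 8.17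
   (`hasSmoothExtensionPast_of_bounded_holds`, PROVED in tree) continues `u` classically (`stub_backEnd`).

## References

* T. Tao, J. Amer. Math. Soc. 29 (2016), arXiv:1402.0290v3, §1.1 (1.3)–(1.5), (1.15), p. 6. [Tao2016AveragedNS]
* J. C. Robinson, J. L. Rodrigo, W. Sadowski, *The three-dimensional Navier–Stokes equations* (2016),
  Thm. 8.17. [RobinsonRodrigoSadowski2016]
* T. Tao, Anal. PDE 6 (2013), arXiv:1108.1165, Cor. 11.1, Thm. 5.4. [Tao2011]
-/

noncomputable section

open MeasureTheory Set Filter Topology FourierTransform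
open scoped ENNReal NNReal RealInnerProductSpace SchwartzMap ContDiff

-- the nested summit namespace `…NavierStokesRegularity.NavierStokesRegularity…` is the tree's layout (D-0017)
set_option linter.dupNamespace false

namespace Summit.NavierStokesRegularity.NavierStokesRegularity.Theorems

open Literature.Analysis.FluidPDE Literature.Analysis.FluidPDE.Tao2016
open Literature.Analysis.FunctionSpaces (eFourierSobolevNorm)
open Literature.Analysis.FunctionSpaces.EuclideanSpace (complexify complexify_apply norm_complexify
  continuous_complexify)

namespace PerpetualPumpEulerTypeIGlue

/-! ## Small proved helpers for the composition -/

/-- A smooth rapidly decaying field is (the coercion of) a Schwartz map. [folklore] -/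
theorem exists_schwartzMap_coe_eq {u₀ : (EuclideanSpace ℝ (Fin 3)) → (EuclideanSpace ℝ (Fin 3))} (hu : ContDiff ℝ ∞ u₀)
    (hdec : HasRapidSpatialDecay u₀) : ∃ f : 𝓢((EuclideanSpace ℝ (Fin 3)), (EuclideanSpace ℝ (Fin 3))), ⇑f = u₀ := by
  refine ⟨⟨u₀, hu, fun k n => ?_⟩, rfl⟩
  obtain ⟨C, hC⟩ := hdec n k
  refine ⟨C, fun x => le_trans ?_ (hC x)⟩
  exact mul_le_mul_of_nonneg_right
    (pow_le_pow_left₀ (norm_nonneg _) (le_add_of_nonneg_left zero_le_one) k) (norm_nonneg _)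

/-- A scalar multiple of a smooth divergence-free field is divergence free. [folklore] -/
theorem isDivFree_const_smul {v : (EuclideanSpace ℝ (Fin 3)) → (EuclideanSpace ℝ (Fin 3))} (hv : ContDiff ℝ 1 v) (hdiv : VectorCalculus.IsDivFree v)
    (c : ℝ) : VectorCalculus.IsDivFree (c • v) := by
  intro x
  have hd : DifferentiableAt ℝ v x := (hv.differentiable one_ne_zero).differentiableAt
  have hx := hdiv x
  unfold VectorCalculus.divergence at hx ⊢
  have h1 : HasFDerivAt (c • v) (c • fderiv ℝ v x) x := hd.hasFDerivAt.const_smul c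
  rw [h1.fderiv, ContinuousLinearMap.toLinearMap_smul, map_smul, hx, smul_zero]

/-- Slab bounds for all `T₁ < T` (not only `0 < T₁`). [folklore] -/
theorem forall_lt_exists_bound {T : ℝ} (hT : 0 < T) {u : ℝ → (EuclideanSpace ℝ (Fin 3)) → (EuclideanSpace ℝ (Fin 3))}
    (h : ∀ T₁ ∈ Ioo 0 T, ∃ M : ℝ, ∀ t ∈ Icc 0 T₁, ∀ x, ‖u t x‖ ≤ M) :
    ∀ T₁ < T, ∃ M : ℝ, ∀ t ∈ Icc 0 T₁, ∀ x, ‖u t x‖ ≤ M := by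
  intro T₁ hT₁
  obtain ⟨M, hM⟩ := h (max T₁ (T / 2)) ⟨lt_max_of_lt_right (by linarith), max_lt hT₁ (by linarith)⟩
  exact ⟨M, fun t ht x => hM t ⟨ht.1, ht.2.trans (le_max_left _ _)⟩ x⟩

end PerpetualPumpEulerTypeIGlue

/-! ## The composition -/

/-- **`EulerTypeIGlue` (stmt-NavierStokesRegularity-1838) holds**: Tao's abstract Type-I exclusion for
symmetric averaged Euler operators with cancellation (the route's `Thesis`) implies that a classical
Leray–Hopf solution of Navier–Stokes from a rapidly decaying datum blowing up at most at the Type-I rate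
extends classically past the putative blow-up time. Composition of the seven landed stubs of line `Sketch`
(x-side front end `stub_identityTests`/`stub_cubic`/`stub_testToH10`, regularity `stub_memH10`/
`stub_continuity`, viscosity normalisation `stub_normalise`, RRS-8.17 back end `stub_backEnd`).
[cite: Tao2016AveragedNS, §1.1 (1.3)-(1.5), (1.15), p. 6] -/
theorem perpetualPump_eulerTypeIGlue_proof : Theses.PerpetualPump.EulerTypeIGlue := by
  intro hTh ν T hν hT u p hcl hLH hdec hTI
  -- (0) slab bounds and the Type-I rate on all of `[0,T)`
  have hslab := exists_forall_norm_le_of_tao2011 tao2011_hasBoundedSobolevNormsOn_holds hν hcl hLH hdec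
  obtain ⟨C, hC⟩ := hTI.exists_sqrt_mul_norm_le (PerpetualPumpEulerTypeIGlue.forall_lt_exists_bound hT hslab)
  -- (1) the Tao-side curve `U t = [(u t)^ℂ]`
  have h2 : ∀ t ∈ Ico 0 T, MemLp (complexify ∘ u t) 2 (volume : Measure (EuclideanSpace ℝ (Fin 3))) := fun t ht =>
    PerpetualPumpEulerTypeIGlue.memLp_complexify_of_memLp (hLH.memLp t ⟨ht.1, ht.2.le⟩)
  classical
  set U : ℝ → L2C := fun t => if ht : t ∈ Ico 0 T then (h2 t ht).toLp _ else 0 with hUdef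
  have hU_eq : ∀ t (ht : t ∈ Ico 0 T), U t = (h2 t ht).toLp _ := fun t ht => by
    simp only [hUdef, dif_pos ht]
  have hU : ∀ t ∈ Ico 0 T, ((U t : L2C) : (EuclideanSpace ℝ (Fin 3)) → (EuclideanSpace ℂ (Fin 3))) =ᵐ[volume] complexify ∘ u t := fun t ht => by
    rw [hU_eq t ht]
    exact (h2 t ht).coeFn_toLp
  have h0T : (0 : ℝ) ∈ Ico 0 T := ⟨le_rfl, hT⟩
  -- (2) regularity of the curve and Tao's identity at viscosity `ν`
  have hH : ∀ t ∈ Ico 0 T, MemH10df (U t) := PerpetualPumpEulerTypeIGlue.stub_memH10 hν hcl hLH hdec U hU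
  have hc : ContinuousInH10On (Ico 0 T) U := PerpetualPumpEulerTypeIGlue.stub_continuity hν hT hcl hLH hdec U hU
  have hid := PerpetualPumpEulerTypeIGlue.stub_testToH10 U hH hc
    (PerpetualPumpEulerTypeIGlue.stub_identityTests hν hT hcl hLH hdec U hU hH
      (fun hf h2 hH hdf hψ hψ1 hψ' hψ2 => PerpetualPumpEulerTypeIGlue.stub_cubic hf h2 hH hdf hψ hψ1 hψ' hψ2))
  -- (3) the datum as a Schwartz map
  obtain ⟨u₀, hu₀⟩ := PerpetualPumpEulerTypeIGlue.exists_schwartzMap_coe_eq (hcl.contDiff_velocity h0T) hdec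
  have hU0 : U 0 = schwartzL2 u₀ := by
    rw [hU_eq 0 h0T]
    exact MemLp.toLp_congr _ _ (Eventually.of_forall fun x => by rw [hu₀])
  -- (4) the Type-I rate in `L^∞` form
  have hrate : ∃ M : ℝ, ∀ t ∈ Ico 0 T,
      eLpNorm (U t) ⊤ volume ≤ ENNReal.ofReal (M / Real.sqrt (T - t)) := by
    refine ⟨C, fun t ht => ?_⟩
    have hpos : 0 < Real.sqrt (T - t) := Real.sqrt_pos.2 (sub_pos.2 ht.2)
    rw [eLpNorm_congr_ae (hU t ht), eLpNorm_exponent_top]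
    refine eLpNormEssSup_le_of_ae_bound (Eventually.of_forall fun x => ?_)
    rw [Function.comp_apply, norm_complexify, le_div_iff₀ hpos, mul_comm]
    exact hC t ht x
  -- (5) normalise the viscosity and apply the Thesis to the Euler datum
  obtain ⟨hW, M, hM⟩ := PerpetualPumpEulerTypeIGlue.stub_normalise hν u₀ U hU0 hH hc hid hrate
  have hdiv₀ : VectorCalculus.IsDivFree ⇑((ν⁻¹ : ℝ) • u₀) := by
    have h1 : ContDiff ℝ 1 (u 0) := (hcl.contDiff_velocity h0T).of_le (mod_cast le_top)
    have h := PerpetualPumpEulerTypeIGlue.isDivFree_const_smul h1 (hcl.divFree 0 h0T) ν⁻¹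
    rwa [← hu₀] at h
  obtain ⟨T', hT', v, hv, hvW⟩ := hTh AveragingDatum.euler AveragingDatum.euler_isSymmetric
    AveragingDatum.euler_hasCancellation ((ν⁻¹ : ℝ) • u₀) hdiv₀ (ν * T) (mul_pos hν hT) _ hW ⟨M, hM⟩
  have hv' : IsMildSolutionFor AveragingDatum.euler.form (schwartzL2 ((ν⁻¹ : ℝ) • u₀)) (Ico 0 T') v := hv
  -- (6) the back end
  refine PerpetualPumpEulerTypeIGlue.stub_backEnd (a := ν⁻¹) (b := ν) hν hT (inv_pos.2 hν) hν hT' hcl hLH hdec v hv'.1 hv'.2.1 ?_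
  intro t ht
  have hνt : ν * t ∈ Ico 0 (ν * T) := ⟨mul_nonneg hν.le ht.1, mul_lt_mul_of_pos_left ht.2 hν⟩
  rw [hvW (ν * t) hνt, mul_div_cancel_left₀ t hν.ne']
  filter_upwards [Lp.coeFn_smul (((ν⁻¹ : ℝ) : ℂ)) (U t), hU t ht] with x hx hx'
  rw [hx, Pi.smul_apply, hx', Function.comp_apply]


end Summit.NavierStokesRegularity.NavierStokesRegularity.Theorems

end
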